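import Summits.QuantumFields.YangMills.Theorems.BalabanUVNodesN05SubBP2DSlotExistsLawLanGammaPrime
import Summits.QuantumFields.YangMills.Theorems.BalabanUVNodesN05JunctionHMemberSuppliers

/-!
# BalabanUVNodes ∕ N05 ([Balaban1985RegularSpaces] Lemma 1 p. 79 – Thm 8 p. 101): THE J-N06→N05 JUNCTION APPLIED ON THE «P₂D» ROAD BY NAME — the N05 row
# `∃ lam c₁ ρ₀, B8LeafOfRecordSubBP₂D θ (lam.cutSubBP₅ c₁ ρ₀)` from [4]'s letters, N06's THEOREM 3.3 AS PRINTED (`B9.Thm33Printed`, by name, at any frame) and the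
# junction's frame↔`ℤᵈ` dictionary binders at the (1.3)–(1.5)-admissible members — the three b9 socket families of the row supplier of record SUPPLIED

Track A of `YM-PLAN.md` (cell `pub-ymgap`, HUMAN RULING D-0062), node **N05** = [Balaban1985RegularSpaces] («B8»), in-edge **N06** = [Balaban1985BackgroundPropagators]
(«B9», print's ref. [4]); seat `pub-ymgap-dag-n05-d` (g13), 2026-08-28; bears on K1⁹ `stmt-QuantumFields-27364` (`--supports … --as helper`, count-neutral).

WHY (strategy s2 = by-name knit at the record).  The N05 row supplier of record — `BalabanUVNodesN05SubBP2DSlotExistsLawLanGammaPrime.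
exists_residB8_b8LeafOfRecordSubBP₂D_cutSubBP₅_of_lettersSrc_γ'` (p619291; «P₂D» edition: the (1.5)-obeying index `Node00.IdxB8SubD θ`, Proposition 5's family pinned
by name at dag-n05-w1's P₅-cut) — displays FIVE [4]-type hypothesis families at the (1.3)–(1.5)-admissible `Ω₀ = ℤᵈ` law members: [4] Thm 3.1's letters `SLet ∕
SLetUB` and three [4]-Thm-3.3-type sockets `SB9P` (Prop. 3's frame, sourceless, both-points Hölder line — `SockB9P3H2`), `SB9srcHP` (Prop. 3's frame with source, five
(1.59) lines), `SH59src` (Thm 4's frame (1.146) with source, radius-uniform).  dag-n06-b's junction lineage has LANDED the member-level theorems producing exactly these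
three texts from [4] Thm 3.3's blocks (3.42)–(3.47) at an abstract frame tied to the `ℤᵈ` objects by dictionary binders (`B9SupplySockB9P3ZdAtHerm.sockB9P3PIδ2H_at_univ`,
`B9SupplySockB9P3ZdGammaUnivDelta2Src.sockSrc_core_at_univ_linPIδ2H`), and N06's statement of record for Theorem 3.3 is `B9.Thm33Printed c35 geo bg Gp GA`, whose
`GA`-half IS the junction's block letter `H`.  The companion `BalabanUVNodesN05JunctionHMemberSuppliers` reads the junction theorems into the three socket currencies at
one member; this file COMPOSES: the last junction-applied N05 knit was the H-slot-era `BalabanUVNodesN05SubBHKnitUnivOfThm33` (p551339, over the refuted law-№12 class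
`towerBonds`); since the P → P₂C → P₂D re-keys none existed.  Here the class is print's `towerBondsP` and the members are the (1.5)-admissible ones.

WHAT IS PROVED (one theorem; composition of landed theorems + constant bookkeeping; no estimate; no new definition):
* ★★★ **`exists_residB8_b8LeafOfRecordSubBP₂D_cutSubBP₅_of_letters_thm33_junctionH`** — for `θ : Node00.Stage3Params` with `2 ≤ θ.D`, `5 ≤ θ.L`: [4] Thm 3.1's letters
  `SLet ∕ SLetUB` at the (1.3)–(1.5)-admissible law members (p619291's texts VERBATIM) + ANY frame `(I, geo, bg, Gp, GA, mem, ιCfg, ιLoc, ops)` carrying N06's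
  **`B9.Thm33Printed c35 geo bg Gp GA`** + the junction's dictionary binders `DictAt ∕ Prop6At ∕ InvAtH ∕ CurvAtInAk ∕ LandauAt ∕ AvgAtP` (class print's `towerBondsP`) `∕
  HolderAtδ2 ∕ LinBddAt ∕ SrcAt ∕ SrcHolderAtδ2` at every `j : Node00.IdxB8SubD θ`, GUARDED `1 ≤ M → M₃ ≤ M → m ≤ j.k →` (n06-b's binder texts by name) + the
  junction's primitive constants (`0 < c₆ K₆ a₃`, `0 ≤ c69 q c_S c_Sβ`) + Theorem 8's source factor `1 ≤ γ₈` ⊢ **`∃ lam c₁ ρ₀, B8LeafOfRecordSubBP₂D θ (lam.cutSubBP₅ c₁ ρ₀)`**.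
  Proof: unpack `Thm33Printed` (`M₁ δ₀ a₀ B₀ Bβ Bε Bεβ`, the `GA`-half `H`); `M := max 1 (max M₁ M₃)`; constants `B₀′ := max 1 (2B₀·max 1 q)`, `cP := min (1∕16) …`,
  `B₀β′ := 2·max 0 (C_H δ₀(B₀ + max 0 (Bβ β)))·max 1 q + 1`, `γ′ = γ″ := 2c_Sγ₈∕B₀′`, `γβ := (C_βc_S∕B₀ + c_Sβ)γ₈`; the three families member by member from the
  companion file; ONE application of p619291.
HONEST FRAMING: by-name composition; 0 estimates; the displayed [4] letters and junction binders are HYPOTHESES — N06's object layer ([4] Thm 3.1's operators and Thm 3.3's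
frame on `ℤᵈ`, m ≥ 1 OPEN; satisfiability class-wide NOT claimed; no positive A6 witness claimed); `Thm33Printed` is N06's statement, unproved; Proposition 7 inside the
slot in the repaired currency `c₇OfRecord` (WATCH-P7-CURRENCY-RECORD); count-neutral; **N05 NOT discharged**; K1⁸ NOT claimed; Bałaban AS PRINTED with locators; one
finite 𝕋⁴ programme at fixed ε; nothing continuum ∕ ℝ⁴ ∕ OS ∕ mass-gap ∕ Clay.  No `sorry`, no new definition.  Unit `pub-ymgap-dag-n05-d` (g13).
[cite: Balaban1985RegularSpaces, Lemma 1 p.79, Thm 2 p.83, Prop. 3 p.87, Thm 4 p.88, Prop. 5 (1.106)–(1.110) p.94, Prop. 6 p.99, Prop. 7 p.100, Thm 8 (1.146) p.101, (1.3)–(1.5) p.77, (1.59) p.86; Balaban1985BackgroundPropagators, Thm 3.1 p.397, Thm 3.3 p.399, (3.42)–(3.47) pp.397–398, (3.26)–(3.27) p.395]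
-/

noncomputable section

namespace Summit.QuantumFields.YangMills.BalabanUVNodes.N05SubBP2DSlotExistsOfThm33JunctionH

open Literature.MathematicalPhysics.QuantumFieldTheory.Balaban1983to89
open Literature.MathematicalPhysics.QuantumFieldTheory.Balaban1983to89.Node00
open Literature.MathematicalPhysics.QuantumFieldTheory.Balaban1983to89.B8IdxB8LawsB (IdxB8LawsB IdxB8SubB)
open Literature.MathematicalPhysics.QuantumFieldTheory.Balaban1983to89.B8LeafModelZd (ZdIdx)
open Literature.MathematicalPhysics.QuantumFieldTheory.Balaban1983to89.B8LeafModelZd3 (SockB9P3)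
open Literature.MathematicalPhysics.QuantumFieldTheory.Balaban1983to89.B9SupplySockB9P3ZdGammaUnivDelta2 (SockB9P3H2)
open Literature.MathematicalPhysics.QuantumFieldTheory.Balaban1983to89.B8LeafModelZd3P (zdGF3P zdGF3HP)
open Literature.MathematicalPhysics.QuantumFieldTheory.Balaban1983to89.B8LeafModelZd3P2 (zdGF3P₂ zdGF3HP₂)
open Literature.MathematicalPhysics.QuantumFieldTheory.Balaban1983to89.B8TowerBondsPrinted (towerBondsP)
open Literature.MathematicalPhysics.QuantumFieldTheory.Balaban1983to89.B8SockLettersRD (SockLettersRD)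
open Literature.MathematicalPhysics.QuantumFieldTheory.Balaban1983to89.B8Lemma1NonAbelian (mulCfg blockPairNA)
open Literature.MathematicalPhysics.QuantumFieldTheory.Balaban1983to89.B8LanF146 (LanF146)
open Literature.MathematicalPhysics.QuantumFieldTheory.Balaban1983to89.B8Eq138LandauZd (covLap QT InR138 IsLandau146W)
open Literature.MathematicalPhysics.QuantumFieldTheory.Balaban1983to89.B8Prop5LandauDataZd (ZdLanIdx zdLan)
open Summit.QuantumFields.YangMills.BalabanUVNodes.N05SubBP2DSlotGammaPrime (b8LeafOfRecordSubBP₂D_cutSubBP_zdLan_printCube_of_knit_lettersSrc_γ')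
open Summit.QuantumFields.YangMills.BalabanUVNodes.N05SubBP2CSlotExistsGammaPrime (exists_residB8_layer)
open MatrixLog B7Prop1Explicit B7Prop2Explicit B7Prop1Local B7Eq92Concrete
open B8Ineq130 (tlo thi)
open B8Ineq132 (InAk covDerivFwd)
open B7Eq78Linearization (zdBlocking QprimeIter)
open B8Eq119TwistedAxial (bgT Restr129 InAx)
open B8Eq140Level (SideTouches)
open B8Eq1117Concrete (XSpace)
open B8Prop5ContractionKLevel (Bd2)
open B8LambdaSpaceKLevel (wt)
open B8Eq184Proof (gaugeExp cfgExp)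
open B8Eq146AExpansion (iEta plaqCovDeriv)
open B8Eq143PlaqExpansion (pdiv)
open B7Prop4GeneralLevels (linCovIter)
open B8Eq155JBound (Jcur wsup)
open B8ScaledSupNorm (bondNorm msup Bdd)
open B9Eq340HolderZd (hquot AdmPair)

open B9SupplySockB9P3ZdLetters (OpsZd)
open B9SupplySockB9P3ZdAt (DictAt Prop6At LandauAt SrcAt)
open B9SupplySockB9P3ZdAtLin (LinBddAt)
open B9SupplySockB9P3ZdGammaUniv (AvgAtP)
open B9SupplySockB9P3ZdGammaInAk (CurvAtInAk)
open B9SupplySockB9P3ZdGammaUnivDelta2 (HolderAtδ2)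
open B9SupplySockB9P3ZdAtHerm (InvAtH)
open B9SupplySockB9P3ZdGammaUnivDelta2Src (SrcHolderAtδ2)
open Summit.QuantumFields.YangMills.BalabanUVNodes.N05SubBP2DSlotExistsLawLanGammaPrime (exists_residB8_b8LeafOfRecordSubBP₂D_cutSubBP₅_of_lettersSrc_γ')
open Summit.QuantumFields.YangMills.BalabanUVNodes.N05JunctionHMemberSuppliers (sockB9P3H2_member_of_junctionH sB9srcHP_member_of_junctionH sH59src_member_of_junctionH)

-- `Site` alone could resolve to the torus sites of `Setup.lean`; re-export the `ℤ^d` sites of `B7Prop1Explicit`.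
export B7Prop1Explicit (Site)

section JunctionH

/-- Theorem 8's guard `2 ≤ 5dL·B₀` at the junction's constant `B₀′ ≥ 1` (`d ≥ 2`, `L ≥ 5`). [cite: Balaban1985RegularSpaces, Thm 8 p.101 (bookkeeping)] -/
private theorem two_le_guard {D L B : ℝ} (hD : 2 ≤ D) (hL : 5 ≤ L) (hB : 1 ≤ B) : 2 ≤ 5 * D * L * B := by
  have hDL : 10 ≤ D * L := by nlinarith
  nlinarith [mul_nonneg (sub_nonneg.2 hDL) (sub_nonneg.2 hB)]

/-- ★★★ **THE J-N06→N05 JUNCTION APPLIED ON THE «P₂D» ROAD BY NAME** — the N05 row `∃ lam c₁ ρ₀, B8LeafOfRecordSubBP₂D θ (lam.cutSubBP₅ c₁ ρ₀)` (the four-pin engine's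
`h05`, Proposition 5's family = print's p. 94 family at dag-n05-w1's P₅-pin) from: [Balaban1985BackgroundPropagators] Thm 3.1's letters `SLet ∕ SLetUB` at the
(1.3)–(1.5)-admissible `Ω₀ = ℤᵈ` law members; N06's **Theorem 3.3 AS PRINTED `B9.Thm33Printed c35 geo bg Gp GA`** at ANY frame; dag-n06-b's junction dictionary binders at
every `j : Node00.IdxB8SubD θ` (guarded `1 ≤ M → M₃ ≤ M → m ≤ j.k`); the junction's primitive constants.  Proof: the three b9 socket families `SB9P ∕ SH59src ∕ SB9srcHP`
of p619291 SUPPLIED member by member (`BalabanUVNodesN05JunctionHMemberSuppliers`), then ONE application of p619291.  Hypotheses are N06 content; N05 NOT discharged.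
[cite: Balaban1985RegularSpaces, Lemma 1 – Thm 8 pp.79–101, Prop. 5 p.94, (1.3)–(1.5) p.77, (1.59) p.86; Balaban1985BackgroundPropagators, Thm 3.1 p.397, Thm 3.3 p.399, (3.42)–(3.47) pp.397–398] -/
theorem exists_residB8_b8LeafOfRecordSubBP₂D_cutSubBP₅_of_letters_thm33_junctionH (θ : Stage3Params) (hD : 2 ≤ θ.D) (hL5 : 5 ≤ θ.L)
    -- [Balaban1985BackgroundPropagators] Thm 3.1's letter bounds and threshold
    {B₀'H B₂' BG BR cL : ℝ} (hB₀'H : 0 < B₀'H) (hB₂' : 0 ≤ B₂') (hBG : 0 ≤ BG) (hBR : 0 ≤ BR) (hcL : 0 < cL)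
    -- [4]'s letters AT THE (1.3)–(1.5)-ADMISSIBLE `Ω₀ = ℤᵈ` LAW MEMBERS (p619291's texts verbatim): existence side and uniqueness side
    (SLet : ∀ i : ZdIdx θ.D θ.L, i.Ω 0 = Set.univ → IdxB8LawsB θ.L i → B8ConstraintBonds.DomainSeq θ.L i.Ω → (∀ l, l < i.k → ∀ z ∈ i.Λs i.k l, ((θ.L : ℤ) ^ l) • z ∈ B8ConstraintBonds.Lam θ.L i.Ω l) → SockLettersRD (𝔸 := θ.𝔸) θ.L BG BR B₀'H B₂' cL i.η i.k i.Ω i.Λs)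
    (SLetUB : ∀ i : ZdIdx θ.D θ.L, i.Ω 0 = Set.univ → IdxB8LawsB θ.L i → B8ConstraintBonds.DomainSeq θ.L i.Ω → (∀ l, l < i.k → ∀ z ∈ i.Λs i.k l, ((θ.L : ℤ) ^ l) • z ∈ B8ConstraintBonds.Lam θ.L i.Ω l) → ∀ α₀ : ℝ, 0 < α₀ → α₀ ≤ cL → ∀ U₀ : Site θ.D → Fin θ.D → θ.𝔸ˣ, (∀ x κ, U₀ x κ ∈ unitaryUnits θ.𝔸) →
      InAk θ.L i.k i.η α₀ i.Ω U₀ →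
      ∃ (g Δ : (Site θ.D → θ.𝔸) →ₗ[ℂ] (Site θ.D → θ.𝔸)) (q : (Site θ.D → θ.𝔸) →ₗ[ℂ] (ℕ → Site θ.D → θ.𝔸))
        (qs : (ℕ → Site θ.D → θ.𝔸) →ₗ[ℂ] (Site θ.D → θ.𝔸)) (Aw c : (ℕ → Site θ.D → θ.𝔸) →ₗ[ℂ] (ℕ → Site θ.D → θ.𝔸))
        (H' : XSpace θ.D i.k θ.𝔸 →ₗ[ℂ] (Site θ.D → θ.𝔸)),
        (∀ x : Site θ.D → θ.𝔸, (∃ C : ℝ, ∀ y, ‖x y‖ ≤ C) → g (Δ x + qs (Aw (q x))) = x) ∧ (∀ φ, qs (c (q (g (g (qs φ))))) = qs φ) ∧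
        (∀ (f : Site θ.D → θ.𝔸), ∀ x ∈ i.Ω 0, Δ f x = covLap i.η U₀ ((i.Ω 0).indicator f) x) ∧
        (∀ (μ : ℕ → Site θ.D → θ.𝔸), ∀ x ∈ i.Ω 0, qs μ x = QT θ.L i.k (i.Λs i.k) U₀ μ x) ∧
        (∀ (f : Site θ.D → θ.𝔸) (n : ℕ), n ≤ i.k → ∀ y ∈ i.Λs i.k n, q f n y = QprimeIter (zdBlocking θ.D θ.L) (bgT θ.L U₀) n f y) ∧
        (∀ (f : Site θ.D → θ.𝔸) (n : ℕ) (y : Site θ.D), ¬ (n ≤ i.k ∧ y ∈ i.Λs i.k n) → q f n y = 0) ∧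
        (∀ (X : XSpace θ.D i.k θ.𝔸) (x : Site θ.D), ‖H' X x‖ ≤ B₀'H * ‖X‖) ∧
        (∀ n, n ≤ i.k → ∀ (X : XSpace θ.D i.k θ.𝔸), ∀ p ∈ {b : Site θ.D × Fin θ.D | SideTouches (i.Ω n) b.1 b.2},
          wt θ.L i.η n * ‖covDerivFwd i.η U₀ p.2 (H' X) p.1‖ ≤ B₀'H * ‖X‖) ∧
        (∀ X : XSpace θ.D i.k θ.𝔸, Bd2 θ.L i.η i.k i.Ω (covLap i.η U₀ (H' X)) (B₂' * ‖X‖)) ∧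
        (∀ (Y : XSpace θ.D i.k θ.𝔸) (n : ℕ) (hn : n ≤ i.k) (y : Site θ.D), y ∈ i.Λs i.k n →
          QprimeIter (zdBlocking θ.D θ.L) (bgT θ.L U₀) n (H' Y) y = Y (⟨n, Nat.lt_succ_of_le hn⟩, y)) ∧
        (∀ (f : Site θ.D → θ.𝔸) (r : ℝ), 0 ≤ r → Bd2 θ.L i.η i.k i.Ω f r →
          (∀ x, ‖g f x‖ ≤ BG * r) ∧ ∀ n, n ≤ i.k → ∀ p ∈ {b : Site θ.D × Fin θ.D | SideTouches (i.Ω n) b.1 b.2},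
            wt θ.L i.η n * ‖covDerivFwd i.η U₀ p.2 (g f) p.1‖ ≤ BG * r) ∧
        (∀ (f : Site θ.D → θ.𝔸) (r : ℝ), 0 ≤ r → Bd2 θ.L i.η i.k i.Ω f r → Bd2 θ.L i.η i.k i.Ω (f - g (qs (c (q (g f))))) (BR * r)))
    -- N06's FRAME for [4] Thm 3.3 (any index type, geometries, backgrounds, the two kernel families of Thms 3.1–3.3) and its `ℤᵈ` dictionary maps
    {I : Type} (geo : I → B9.Geometry) (bg : I → B9.Backgrounds) (Gp GA : ∀ i, B9.KernelFamily (geo i) (bg i))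
    (mem : ℝ → ZdIdx θ.D θ.L → ℕ → I)
    (ιCfg : ∀ (M : ℝ) (i : ZdIdx θ.D θ.L) (m : ℕ) (U₀ : Site θ.D → Fin θ.D → θ.𝔸ˣ), (∀ x κ, U₀ x κ ∈ unitaryUnits θ.𝔸) → (bg (mem M i m)).Cfg)
    (ιLoc : ∀ (M : ℝ) (i : ZdIdx θ.D θ.L) (m : ℕ), (Site θ.D → Fin θ.D → θ.𝔸) → (geo (mem M i m)).Loc)
    (ops : ℝ → ZdIdx θ.D θ.L → ℕ → OpsZd θ.D θ.𝔸)
    {c35 c₆ K₆ M₃ a₃ c69 q β cS cSβ : ℝ} {CH : ℝ → ℝ} {len : Site θ.D → ℝ}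
    -- N06's THEOREM 3.3 AS PRINTED, by name
    (h33 : B9.Thm33Printed c35 geo bg Gp GA)
    -- dag-n06-b's JUNCTION DICTIONARY BINDERS at the (1.3)–(1.5)-admissible members, guarded (N06 object layer; HYPOTHESES)
    (hdict : ∀ (M : ℝ) (j : IdxB8SubD θ) (m : ℕ), 1 ≤ M → M₃ ≤ M → m ≤ j.1.1.1.1.k → DictAt geo bg GA θ.L mem ιCfg ιLoc ops M j.1.1.1.1 m)
    (hP6 : ∀ (M : ℝ) (j : IdxB8SubD θ) (m : ℕ), 1 ≤ M → M₃ ≤ M → m ≤ j.1.1.1.1.k → Prop6At bg θ.L mem ιCfg c35 c₆ K₆ M j.1.1.1.1 m)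
    (hinv : ∀ (M : ℝ) (j : IdxB8SubD θ) (m : ℕ), 1 ≤ M → M₃ ≤ M → m ≤ j.1.1.1.1.k → InvAtH bg θ.L mem ιCfg ops c35 a₃ M j.1.1.1.1 m)
    (hcurv : ∀ (M : ℝ) (j : IdxB8SubD θ) (m : ℕ), 1 ≤ M → M₃ ≤ M → m ≤ j.1.1.1.1.k → CurvAtInAk θ.L ops c69 M j.1.1.1.1 m)
    (hlan : ∀ (M : ℝ) (j : IdxB8SubD θ) (m : ℕ), 1 ≤ M → M₃ ≤ M → m ≤ j.1.1.1.1.k → LandauAt bg θ.L mem ιCfg ops c35 a₃ M j.1.1.1.1 m)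
    (havg : ∀ (M : ℝ) (j : IdxB8SubD θ) (m : ℕ), 1 ≤ M → M₃ ≤ M → m ≤ j.1.1.1.1.k →
      AvgAtP θ.L ops q (fun m' l => towerBondsP θ.L j.1.1.1.1.Ω (j.1.1.1.1.Λs m') l) M j.1.1.1.1 m)
    (hhol : ∀ (M : ℝ) (j : IdxB8SubD θ) (m : ℕ), 1 ≤ M → M₃ ≤ M → m ≤ j.1.1.1.1.k → HolderAtδ2 geo bg GA θ.L mem ιCfg ops β len CH M j.1.1.1.1 m)
    (hlin : ∀ (M : ℝ) (j : IdxB8SubD θ) (m : ℕ), 1 ≤ M → M₃ ≤ M → m ≤ j.1.1.1.1.k → LinBddAt θ.L ops M j.1.1.1.1 m)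
    (hsrc : ∀ (M : ℝ) (j : IdxB8SubD θ) (m : ℕ), 1 ≤ M → M₃ ≤ M → m ≤ j.1.1.1.1.k → SrcAt bg θ.L mem ιCfg ops c35 a₃ cS M j.1.1.1.1 m)
    (hsrcH : ∀ (M : ℝ) (j : IdxB8SubD θ) (m : ℕ), 1 ≤ M → M₃ ≤ M → m ≤ j.1.1.1.1.k → SrcHolderAtδ2 bg θ.L mem ιCfg ops c35 a₃ β len cSβ M j.1.1.1.1 m)
    -- the junction's primitive constants ([4] (3.35)∕Prop. 6 `c₆ K₆`, (3.27) `a₃`, (3.69) `c69`, (3.16) `q`, source `c_S c_Sβ`) and Theorem 8's source size factor `γ₈`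
    (hc₆ : 0 < c₆) (hK₆ : 0 < K₆) (ha₃ : 0 < a₃) (hc69 : 0 ≤ c69) (hq : 0 ≤ q) (hcS : 0 ≤ cS) (hcSβ : 0 ≤ cSβ) {γ₈ : ℝ} (hγ₈ : 1 ≤ γ₈) :
    ∃ (lam : ResidB8 θ) (c₁ : ℝ) (ρ₀ : ℕ), B8LeafOfRecordSubBP₂D θ (lam.cutSubBP₅ c₁ ρ₀) := by
  have hL1 : 1 ≤ θ.L := le_trans (by norm_num) hL5
  -- N06's Theorem 3.3: the constants and the `G(U)`-half of its block letter
  obtain ⟨M₁, δ₀, a₀, B₀, Bβ, Bε, Bεβ, -, hδ₀, ha₀, hB₀, H33⟩ := h33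
  have H : ∀ i : I, M₁ ≤ (geo i).M → ∀ α₀ : ℝ, 0 < α₀ → (geo i).M * α₀ ≤ a₀ → ∀ U : (bg i).Cfg, (bg i).Reg335 c35 α₀ U →
      B9.Ineq342_346_347 (GA i) B₀ δ₀ U ∧ B9.Ineq343_345 (GA i) Bβ Bε Bεβ δ₀ U :=
    fun i hM α hα hMa U hreg => (H33 i hM α hα hMa U hreg).2
  -- the big-block size at which the junction is read
  obtain ⟨M, hM_def⟩ : ∃ M : ℝ, M = max 1 (max M₁ M₃) := ⟨_, rfl⟩
  have hM1 : 1 ≤ M := by rw [hM_def]; exact le_max_left _ _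
  have hMM₁ : M₁ ≤ M := by rw [hM_def]; exact (le_max_left _ _).trans (le_max_right _ _)
  have hMM₃ : M₃ ≤ M := by rw [hM_def]; exact (le_max_right _ _).trans (le_max_right _ _)
  have hM0 : 0 < M := lt_of_lt_of_le one_pos hM1
  have hKM : 0 < K₆ * M := mul_pos hK₆ hM0
  -- the junction's output constants, named
  obtain ⟨cP, hcP_def⟩ : ∃ cP : ℝ,
      cP = min (1 / 16) (min (c₆ / M) (min (a₀ / (K₆ * M)) (min (a₃ / (K₆ * M)) (1 / (2 * B₀ * c69 * M + 1))))) := ⟨_, rfl⟩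
  have hcP : 0 < cP := by
    rw [hcP_def]
    refine lt_min (by norm_num) (lt_min (div_pos hc₆ hM0) (lt_min (div_pos ha₀ hKM) (lt_min (div_pos ha₃ hKM) ?_)))
    have : 0 < 2 * B₀ * c69 * M + 1 := by positivity
    positivity
  obtain ⟨B', hB'_def⟩ : ∃ B' : ℝ, B' = max 1 (2 * B₀ * max 1 q) := ⟨_, rfl⟩
  have hB'1 : 1 ≤ B' := by rw [hB'_def]; exact le_max_left _ _
  obtain ⟨B₀βc, hB₀βc_def⟩ : ∃ B₀βc : ℝ, B₀βc = 2 * max 0 (CH δ₀ * (B₀ + max 0 (Bβ β))) * max 1 q + 1 := ⟨_, rfl⟩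
  have hB₀β0 : 0 ≤ 2 * max 0 (CH δ₀ * (B₀ + max 0 (Bβ β))) * max 1 q := by positivity
  have hB₀βc : 2 * max 0 (CH δ₀ * (B₀ + max 0 (Bβ β))) * max 1 q ≤ B₀βc := by rw [hB₀βc_def]; linarith
  have hB₀βc0 : 0 < B₀βc := by rw [hB₀βc_def]; linarith
  obtain ⟨γc, hγc_def⟩ : ∃ γc : ℝ, γc = 2 * cS * γ₈ / B' := ⟨_, rfl⟩
  have hγc0 : 0 ≤ γc := by
    have hγ₈0 : 0 ≤ γ₈ := by linarith
    have hB'0 : 0 < B' := by linarith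
    rw [hγc_def]; positivity
  obtain ⟨γβc, hγβc_def⟩ : ∃ γβc : ℝ, γβc = (max 0 (CH δ₀ * (B₀ + max 0 (Bβ β))) * cS / B₀ + cSβ) * γ₈ := ⟨_, rfl⟩
  have hD' : (2 : ℝ) ≤ θ.D := by exact_mod_cast hD
  have hL5' : (5 : ℝ) ≤ θ.L := by exact_mod_cast hL5
  have hB : 2 ≤ 5 * (θ.D : ℝ) * θ.L * B' := two_le_guard hD' hL5' hB'1
  -- the row supplier of record, its three b9 families supplied member by member from the junction
  refine exists_residB8_b8LeafOfRecordSubBP₂D_cutSubBP₅_of_lettersSrc_γ' θ hD hL5 (B₀ := B') (B₀β := B₀βc) (β := β) (len := len) (cB9 := cP)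
    hcP hB₀'H hB₂' hBG hBR hcL SLet SLetUB ?_ (cP3 := cP) (γ₈ := γ₈) (γ' := γc) (γ'' := γc) (γβ := γβc) hcP hγ₈ hγc0 hγc0 hB hB₀βc0 ?_ ?_
  · -- `SB9P`: Prop. 3's frame, sourceless, at the top truncation
    intro i hΩ hl hd hlt
    obtain ⟨j, hj⟩ : ∃ j : IdxB8SubD θ, j.1.1.1.1 = i := ⟨⟨(⟨⟨⟨i, hΩ⟩, hl⟩, hd⟩ : IdxB8SubC θ), hlt⟩, rfl⟩
    subst hj
    exact sockB9P3H2_member_of_junctionH geo bg GA θ.L mem ιCfg ιLoc ops hD hL1 hB₀ hδ₀ H hM1 hMM₁ j.1.1.1.1 hΩ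
      (hdict M j _ hM1 hMM₃ le_rfl) (hP6 M j _ hM1 hMM₃ le_rfl) (hinv M j _ hM1 hMM₃ le_rfl) (hcurv M j _ hM1 hMM₃ le_rfl)
      (hlan M j _ hM1 hMM₃ le_rfl) (havg M j _ hM1 hMM₃ le_rfl) (hhol M j _ hM1 hMM₃ le_rfl) hK₆ hc69 hq hB'_def hcP_def hB₀βc
  · -- `SH59src`: Thm 4's frame with source, every radius `r ≥ 0`
    intro r hr
    have hK₀ : 0 < 2 * (θ.L * (5 * (θ.D : ℝ) * θ.L * 1)) + 8 * (8 * r * (5 * (θ.D : ℝ) * θ.L * 1)) := by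
      have h1 : 0 < 2 * (θ.L * (5 * (θ.D : ℝ) * θ.L * 1)) := by positivity
      have h2 : 0 ≤ 8 * (8 * r * (5 * (θ.D : ℝ) * θ.L * 1)) := by positivity
      linarith
    refine ⟨min cP (cP / (2 * (θ.L * (5 * (θ.D : ℝ) * θ.L * 1)) + 8 * (8 * r * (5 * (θ.D : ℝ) * θ.L * 1)))), lt_min hcP (div_pos hcP hK₀),
      fun i hΩ hl hd hlt => ?_⟩
    obtain ⟨j, hj⟩ : ∃ j : IdxB8SubD θ, j.1.1.1.1 = i := ⟨⟨(⟨⟨⟨i, hΩ⟩, hl⟩, hd⟩ : IdxB8SubC θ), hlt⟩, rfl⟩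
    subst hj
    exact sH59src_member_of_junctionH geo bg GA θ.L mem ιCfg ιLoc ops hD hL1 hB₀ hδ₀ H hM1 hMM₁ j.1.1.1.1 hΩ
      (fun m hm => hdict M j m hM1 hMM₃ hm) (fun m hm => hP6 M j m hM1 hMM₃ hm) (fun m hm => hinv M j m hM1 hMM₃ hm)
      (fun m hm => hcurv M j m hM1 hMM₃ hm) (fun m hm => havg M j m hM1 hMM₃ hm) (fun m hm => hhol M j m hM1 hMM₃ hm)
      (fun m hm => hlin M j m hM1 hMM₃ hm) (fun m hm => hsrc M j m hM1 hMM₃ hm) (fun m hm => hsrcH M j m hM1 hMM₃ hm)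
      hK₆ hc69 hq hcS hcSβ γ₈ hB'_def hcP_def hγc_def r hr
  · -- `SB9srcHP`: Prop. 3's frame with source, five (1.59) lines, at the top truncation
    intro i hΩ hl hd hlt
    obtain ⟨j, hj⟩ : ∃ j : IdxB8SubD θ, j.1.1.1.1 = i := ⟨⟨(⟨⟨⟨i, hΩ⟩, hl⟩, hd⟩ : IdxB8SubC θ), hlt⟩, rfl⟩
    subst hj
    exact sB9srcHP_member_of_junctionH geo bg GA θ.L mem ιCfg ιLoc ops hD hL1 hB₀ hδ₀ H hM1 hMM₁ j.1.1.1.1 hΩ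
      (hdict M j _ hM1 hMM₃ le_rfl) (hP6 M j _ hM1 hMM₃ le_rfl) (hinv M j _ hM1 hMM₃ le_rfl) (hcurv M j _ hM1 hMM₃ le_rfl)
      (havg M j _ hM1 hMM₃ le_rfl) (hhol M j _ hM1 hMM₃ le_rfl) (hlin M j _ hM1 hMM₃ le_rfl) (hsrc M j _ hM1 hMM₃ le_rfl)
      (hsrcH M j _ hM1 hMM₃ le_rfl) hK₆ hc69 hq hcS hcSβ γ₈ hB'_def hcP_def hγc_def hγβc_def hB₀βc

end JunctionH

end Summit.QuantumFields.YangMills.BalabanUVNodes.N05SubBP2DSlotExistsOfThm33JunctionH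

end
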